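import Mathlib
import Literature.NumberTheory.EllipticCurves.NewformPeterssonSizeCMReductionProofs
import Literature.NumberTheory.EllipticCurves.NewformPeterssonSizeSymmSqLZeroFreeProofs
import Literature.NumberTheory.EllipticCurves.LFunctionCoefficientBound
import Literature.NumberTheory.EllipticCurves.NewformSymmSquareJ0Hecke
import HarnessLib

/-!
# KimSymmetricFourthGL2

Topic `Literature/NumberTheory/Automorphic`. Named literature fact(s) relocated by the gate from `Summits/ABC/ABC/Theorems/DefiniteXiPeterssonLowerBound.lean`
(accept-time relocation of `[cite]`d propositions written inline in a Summits proposal; human ruling 2026-08-15).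
Sources: GodementJacquet1972, IwaniecKowalski2004, Kim2003, KimShahidi2002, KimShahidiCusp2002, Rouse2007.

* `Literature.NumberTheory.Automorphic.Kim2003_symmFourL_nonCM_entire_polyBound`
-/

namespace Literature.NumberTheory.Automorphic

open scoped Real Topology
open Set Filter Metric Complex CongruenceSubgroup
open Literature.NumberTheory.EllipticCurves.ModularForms
open Literature.NumberTheory.LFunctions

/-- **The symmetric fourth power `L`-function of a non-CM elliptic curve over `ℚ` is entire and
polynomially bounded in the conductor.** For an elliptic curve `W/ℚ` without complex
multiplication and its newform `f ∈ S₂(Γ₀(N))` (`IsNewformOf W f`, so `N = N_W` and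
`a_p(f) = a_p(W)`), write `a_p/√p = 2cos θ_p` at `p ∤ N` (Hasse) and
`P_k = C_k(a_p/√p) = 2cos kθ_p` (Chebyshev `C`). The good-prime symmetric fourth Euler product
`L^{(N)}(s, Sym⁴ E) = ∏_{p ∤ N} ∏_{j=-2}^{2} (1 − e^{2ijθ_p} p^{−s})^{−1}
  = exp(∑_{p ∤ N} ∑_{k ≥ 1} (P_k⁴ − 3P_k² + 1) k^{−1} p^{−ks})`
(`T₄(x) = x⁴ − 3x² + 1` is the trace of the symmetric fourth power of an element of `SL₂(ℂ)` of
trace `x`, [cite: KimShahidiCusp2002, §4 p. 194]) converges absolutely on `Re s > 1` and is the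
restriction of an ENTIRE function which is bounded by `C · N^K` on the disc `|s − 2| ≤ 3/2`, with
absolute constants `C, K`. In print this is the conjunction of: `Sym⁴ π_E` is an automorphic
representation of `GL₅(𝔸_ℚ)` [cite: Kim2003, Thm. B]; it is cuspidal unless `π_E` is of dihedral,
tetrahedral or octahedral type [cite: KimShahidiCusp2002, Thm. 3.3.7 and Prop. 3.3.8], and the
representation of a non-CM holomorphic newform of weight `≥ 2` is of none of these types
[cite: KimShahidi2002, §6, Lemma 6.5 and p. 871] (dihedral = CM by Ribet); the standard `L`-function
of a cuspidal automorphic representation of `GL_n` is entire and bounded in vertical strips with a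
functional equation [cite: GodementJacquet1972, Thm. 13.8], whence the convexity bound in terms of
the analytic conductor [cite: IwaniecKowalski2004, §5.2 (5.20)], the conductor of `Sym⁴ π_E` being
bounded by a power of `N` [cite: Rouse2007, Lemma 2.1]; the finitely many inverted local factors at
`p ∣ N` are polynomials in `p^{−s}` bounded by `N^{O(1)}` on the disc. Stated here in the special
(classical, partial-Euler-product) form consumed by the Goldfeld–Hoffstein–Lieman argument for
`L(s, Sym² f)`. [cite: Kim2003, Thm. B] [file NumberTheory/Automorphic/KimSymmetricFourthGL2] -/
def Kim2003_symmFourL_nonCM_entire_polyBound : Prop :=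
  ∃ C K : ℝ, 1 ≤ C ∧ 0 ≤ K ∧
    ∀ (N : ℕ) [NeZero N] (W : WeierstrassCurve ℚ) [W.IsElliptic] (f : CuspForm (Gamma0 N) 2),
      IsNewformOf W f → ¬ W.HasCM →
      ∃ L₄ : ℂ → ℂ, Differentiable ℂ L₄ ∧
        (∀ s : ℂ, 1 < s.re →
          (∀ p : Nat.Primes, Summable fun k : ℕ ↦
            ‖((if ¬ (p : ℕ) ∣ N then
                  (((Polynomial.Chebyshev.C ℝ (k + 1)).eval ((cuspCoeff f p).re / Real.sqrt p)) ^ 4 -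
                    3 * ((Polynomial.Chebyshev.C ℝ (k + 1)).eval ((cuspCoeff f p).re / Real.sqrt p)) ^ 2 +
                      1) / (k + 1)
                else 0 : ℝ) : ℂ) * (p : ℂ) ^ (-((k + 1 : ℕ) : ℂ) * s)‖) ∧
          (Summable fun p : Nat.Primes ↦ ∑' k : ℕ,
            ‖((if ¬ (p : ℕ) ∣ N then
                  (((Polynomial.Chebyshev.C ℝ (k + 1)).eval ((cuspCoeff f p).re / Real.sqrt p)) ^ 4 -
                    3 * ((Polynomial.Chebyshev.C ℝ (k + 1)).eval ((cuspCoeff f p).re / Real.sqrt p)) ^ 2 +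
                      1) / (k + 1)
                else 0 : ℝ) : ℂ) * (p : ℂ) ^ (-((k + 1 : ℕ) : ℂ) * s)‖) ∧
          L₄ s = Complex.exp (∑' p : Nat.Primes, ∑' k : ℕ,
            ((if ¬ (p : ℕ) ∣ N then
                  (((Polynomial.Chebyshev.C ℝ (k + 1)).eval ((cuspCoeff f p).re / Real.sqrt p)) ^ 4 -
                    3 * ((Polynomial.Chebyshev.C ℝ (k + 1)).eval ((cuspCoeff f p).re / Real.sqrt p)) ^ 2 +
                      1) / (k + 1)
                else 0 : ℝ) : ℂ) * (p : ℂ) ^ (-((k + 1 : ℕ) : ℂ) * s))) ∧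
        ∀ s ∈ closedBall (2 : ℂ) (3 / 2), ‖L₄ s‖ ≤ C * (N : ℝ) ^ K

-- TODO(general form): `Sym⁴ π` is automorphic on `GL₅(𝔸_F)` for every cuspidal `π` on `GL₂(𝔸_F)`
-- (Kim 2003, Thm. B), cuspidal off the dihedral/tetrahedral/octahedral types (Kim–Shahidi 2002),
-- with the full completed `L`-function, functional equation and local factors at every place.

/-! ### Ramanujan at the good primes for the newform of an elliptic curve (PROVED: Hasse is in the tree) -/

end Literature.NumberTheory.Automorphic
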